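import Summits.CriticalPhenomena.PercolationContinuityZ3.Theorems.PercNearOneGluingNoHeavyLowerTailAntitheticApexConeConsistency
import HarnessLib

/-!
# `NoHeavyLowerTail` (stmt-CriticalPhenomena-4575) — antithetic cluster pairs: the zone system of THEOREM K — part 3: INVARIANCE OF
# STANDARD ZONES and the NO-SWALLOWING lemma (prim-hp-2 gen 37, MEMO-gen37 §2)

Support file (`--supports stmt-CriticalPhenomena-4575`, hull-port prover `prim-hp-2`, gen 37).  No definitions, no named facts, no sorries;
standard axioms.  Setting and rule: `…AntitheticApexConeZones`.

For `T, M` in the constraint set with `M` agreeing with `T` or with `Tᶜ` on every zone block of `T`: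
* `ACone.std_inv` — a STANDARD zone (of a vertex `q` reached in `T`) is the same in `M` as soon as `q` is reached in `M` (cluster congruence
  `Antithetic.openCluster_eq_of_agree'`), and `q` IS reached in `M` unless its zone is `{q}` (then `q` has edges of both colours, which an
  unreached vertex of the class cannot have); proved for "red-reached, agreeing with `T`" (`ACone.std_core`) and transported to the other
  three cases by the colour swaps `(T, M) ↦ (Tᶜ, Mᶜ), (T, Mᶜ)`.
* `ACone.exists_swallower` — the zone of a swallowed vertex is the (standard) zone of its swallower.
* `ACone.not_sw_of_unreached` — NO SWALLOWING APPEARS: if `r ∈ R` is unreached in `M`, its `T`-zone is `{r}`, and no reached `q ∈ R`, `q ≠ r`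
  has `r` in its `T`-zone, then `r` is not swallowed in `M` (three cases for the would-be swallower: standard — its zone is invariant and
  would contain `r`; swallowed — reduce to its swallower; small — its star is monochromatic of the wrong colour).
[cite: VandenbergHaggstromKahn2005, §1 p. 3 (open cluster `C_s`)]
-/

noncomputable section

namespace Summit.CriticalPhenomena.PercolationContinuityZ3.Theorems

open Literature.Probability.Percolation
open scoped Classical symmDiff

namespace Antithetic

section ClusterTools

variable {V : Type*}

/-- **Cluster congruence, non-loop form**: if `ω'` agrees with `ω` on every NON-LOOP pair meeting the open cluster of `u` in `ω`, then the
open cluster of `u` is the same in `ω'`. [folklore] -/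
theorem openCluster_eq_of_agree' (ω ω' : BondConfig V) (u : V)
    (h : ∀ x ∈ openCluster ω u, ∀ y, x ≠ y → (s(x, y) ∈ ω ↔ s(x, y) ∈ ω')) :
    openCluster ω' u = openCluster ω u := by
  have key₁ : ∀ {a b : V} (_ : (openGraph ω').Walk a b), a ∈ openCluster ω u → b ∈ openCluster ω u := by
    intro a b p
    induction p with
    | nil => exact id
    | @cons a c b hac _ ih =>
      intro ha
      rw [openGraph_adj] at hac
      have hac' : (openGraph ω).Adj a c := (openGraph_adj ω a c).2 ⟨(h a ha c hac.2).2 hac.1, hac.2⟩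
      exact ih ((show (openGraph ω).Reachable u a from ha).trans hac'.reachable)
  have key₂ : ∀ {a b : V} (_ : (openGraph ω).Walk a b), a ∈ openCluster ω u → a ∈ openCluster ω' u →
      b ∈ openCluster ω' u := by
    intro a b p
    induction p with
    | nil => exact fun _ h => h
    | @cons a c b hac _ ih =>
      intro ha ha'
      rw [openGraph_adj] at hac
      have hc : c ∈ openCluster ω u :=
        (show (openGraph ω).Reachable u a from ha).trans ((openGraph_adj ω a c).2 hac).reachable
      have hac' : (openGraph ω').Adj a c := (openGraph_adj ω' a c).2 ⟨(h a ha c hac.2).1 hac.1, hac.2⟩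
      exact ih hc ((show (openGraph ω').Reachable u a from ha').trans hac'.reachable)
  ext z
  constructor
  · intro hz
    obtain ⟨p⟩ := (show (openGraph ω').Reachable u z from hz)
    exact key₁ p (mem_openCluster_self ω u)
  · intro hz
    obtain ⟨p⟩ := (show (openGraph ω).Reachable u z from hz)
    exact key₂ p (mem_openCluster_self ω u) (mem_openCluster_self ω' u)

end ClusterTools

namespace ACone

section Invariance

variable {V : Type*} {E : Set (Sym2 V)} {s : V} {R : Set V} {T M : Set (Sym2 V)}

/-- A vertex all of whose edges are red is not blue-reached. [folklore] -/
theorem not_blue_of_allRed {r : V} (hrs : r ≠ s) (hm : ∀ u, s(r, u) ∈ E → u ≠ r → s(r, u) ∈ M) :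
    ¬ (openGraph (Mᶜ ∩ E)).Reachable s r := fun h => by
  obtain ⟨u, hu, hur⟩ := Apex.exists_adj_of_reachable hrs h
  exact hu.1 (hm u hu.2 hur)

/-- A vertex all of whose edges are blue is not red-reached. [folklore] -/
theorem not_red_of_allBlue {r : V} (hrs : r ≠ s) (hm : ∀ u, s(r, u) ∈ E → u ≠ r → s(r, u) ∉ M) :
    ¬ (openGraph (M ∩ E)).Reachable s r := fun h => by
  obtain ⟨u, hu, hur⟩ := Apex.exists_adj_of_reachable hrs h
  exact hm u hu.2 hur hu.1

/-- Zones lie inside the star cluster. [this work] -/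
theorem zone_subset_big {r : V} : zone E s R T r ⊆ big E T r := by
  rintro v (rfl | ⟨-, h⟩ | ⟨-, h⟩ | ⟨-, -, -, h⟩)
  · exact Or.inl (mem_openCluster_self _ _)
  · exact Or.inr h
  · exact Or.inl h
  · exact h

/-- The star-cluster relation is symmetric. [this work] -/
theorem mem_big_comm {q r : V} (h : q ∈ big E T r) : r ∈ big E T q := by
  rcases h with h | h
  · exact Or.inl (show (openGraph (T ∩ E)).Reachable r q from h).symm
  · exact Or.inr (show (openGraph (Tᶜ ∩ E)).Reachable r q from h).symm

/-- **Standard-zone invariance, core case** (`q` red-reached in `T`, `M` agreeing with `T` on the block of the zone of `q`): the blue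
cluster of `q` is the same in `M`; `q` is not blue-reached in `M`; if `q` is red-reached in `M` its zone in `M` is its zone in `T`; and `q`
is red-reached in `M` unless its zone is `{q}` (class hypothesis). [this work] -/
theorem std_core (hkey : ∀ (T : Set (Sym2 V)) (x : V), ¬ (openGraph (T ∩ E)).Reachable s x → ¬ (openGraph (Tᶜ ∩ E)).Reachable s x →
      (∀ u, s(x, u) ∈ E → u ≠ x → s(x, u) ∈ T) ∨ (∀ u, s(x, u) ∈ E → u ≠ x → s(x, u) ∉ T))
    {q : V} (hDT : ¬ ((openGraph (T ∩ E)).Reachable s q ∧ (openGraph (Tᶜ ∩ E)).Reachable s q))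
    (hDM : ¬ ((openGraph (M ∩ E)).Reachable s q ∧ (openGraph (Mᶜ ∩ E)).Reachable s q))
    (hq : (openGraph (T ∩ E)).Reachable s q) (hag : ∀ e ∈ ZoneSys.blk E (zone E s R T q), (e ∈ M ↔ e ∈ T)) :
    openCluster (Mᶜ ∩ E) q = openCluster (Tᶜ ∩ E) q ∧ ¬ (openGraph (Mᶜ ∩ E)).Reachable s q ∧
      ((openGraph (M ∩ E)).Reachable s q → zone E s R M q = zone E s R T q) ∧
      ((∃ z ∈ zone E s R T q, z ≠ q) → (openGraph (M ∩ E)).Reachable s q) := by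
  have hZ := zone_of_red (R := R) hDT hq
  have hcl : openCluster (Mᶜ ∩ E) q = openCluster (Tᶜ ∩ E) q := by
    refine openCluster_eq_of_agree' (Tᶜ ∩ E) (Mᶜ ∩ E) q fun x hx y hxy => ?_
    by_cases hE : s(x, y) ∈ E
    · have hb : s(x, y) ∈ ZoneSys.blk E (zone E s R T q) := by
        rw [hZ]
        exact ZoneSys.mk_mem_blk hE hxy (Or.inl hx)
      have := hag _ hb
      simp only [Set.mem_inter_iff, Set.mem_compl_iff, hE, and_true, this]
    · simp only [Set.mem_inter_iff, hE, and_false]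
  have hnb : ¬ (openGraph (Mᶜ ∩ E)).Reachable s q := fun h => by
    have hs : s ∈ openCluster (Mᶜ ∩ E) q := h.symm
    rw [hcl] at hs
    exact hDT ⟨hq, (show (openGraph (Tᶜ ∩ E)).Reachable q s from hs).symm⟩
  refine ⟨hcl, hnb, fun hr => by rw [zone_of_red hDM hr, hcl, hZ], fun ⟨z, hz, hzq⟩ => ?_⟩
  by_contra hr
  have hqs : q ≠ s := ne_source_of_constraint hDT
  -- a red `T`-edge at `q` (reached) and a blue `T`-edge at `q` (into the zone), both in the block, give both colours at `q` in `M`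
  obtain ⟨u, hu, huq⟩ := Apex.exists_adj_of_reachable hqs hq
  rw [hZ] at hz
  obtain ⟨w, hw, hwq⟩ := Apex.exists_adj_of_reachable (η := Tᶜ ∩ E) hzq.symm
    (show (openGraph (Tᶜ ∩ E)).Reachable z q from (show (openGraph (Tᶜ ∩ E)).Reachable q z from hz).symm)
  have hub : s(q, u) ∈ ZoneSys.blk E (zone E s R T q) := ZoneSys.mk_mem_blk hu.2 huq.symm (Or.inl mem_zone_self)
  have hwb : s(q, w) ∈ ZoneSys.blk E (zone E s R T q) := ZoneSys.mk_mem_blk hw.2 hwq.symm (Or.inl mem_zone_self)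
  have huM : s(q, u) ∈ M := (hag _ hub).2 hu.1
  have hwM : s(q, w) ∉ M := fun h => hw.1 ((hag _ hwb).1 h)
  rcases hkey _ _ hr hnb with hm | hm
  · exact hwM (hm w hw.2 hwq)
  · exact hm u hu.2 huq huM

/-- Agreement with `Tᶜ` on a block is agreement of `Mᶜ` with `T`. [this work] -/
theorem agree_compl_left {B : Set (Sym2 V)} (h : ∀ e ∈ B, (e ∈ M ↔ e ∉ T)) : ∀ e ∈ B, (e ∈ Mᶜ ↔ e ∈ T) :=
  fun e he => by rw [Set.mem_compl_iff, h e he, not_not]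

/-- Agreement with `T` on a block is agreement of `Mᶜ` with `Tᶜ`. [this work] -/
theorem agree_compl_both {B : Set (Sym2 V)} (h : ∀ e ∈ B, (e ∈ M ↔ e ∈ T)) : ∀ e ∈ B, (e ∈ Mᶜ ↔ e ∈ Tᶜ) :=
  fun e he => by rw [Set.mem_compl_iff, Set.mem_compl_iff, h e he]

/-- **Standard-zone invariance** (all four cases: `q` red- or blue-reached in `T`, `M` agreeing with `T` or with `Tᶜ` on the block): if `q`
is reached in `M` then its zone in `M` equals its zone in `T`; and `q` is reached in `M` unless its zone is `{q}`. [this work] -/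
theorem std_inv (hkey : ∀ (T : Set (Sym2 V)) (x : V), ¬ (openGraph (T ∩ E)).Reachable s x → ¬ (openGraph (Tᶜ ∩ E)).Reachable s x →
      (∀ u, s(x, u) ∈ E → u ≠ x → s(x, u) ∈ T) ∨ (∀ u, s(x, u) ∈ E → u ≠ x → s(x, u) ∉ T))
    {q : V} (hDT : ¬ ((openGraph (T ∩ E)).Reachable s q ∧ (openGraph (Tᶜ ∩ E)).Reachable s q))
    (hDM : ¬ ((openGraph (M ∩ E)).Reachable s q ∧ (openGraph (Mᶜ ∩ E)).Reachable s q))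
    (hq : (openGraph (T ∩ E)).Reachable s q ∨ (openGraph (Tᶜ ∩ E)).Reachable s q)
    (hag : (∀ e ∈ ZoneSys.blk E (zone E s R T q), (e ∈ M ↔ e ∈ T)) ∨
      (∀ e ∈ ZoneSys.blk E (zone E s R T q), (e ∈ M ↔ e ∉ T))) :
    (((openGraph (M ∩ E)).Reachable s q ∨ (openGraph (Mᶜ ∩ E)).Reachable s q) → zone E s R M q = zone E s R T q) ∧
      ((∃ z ∈ zone E s R T q, z ≠ q) → (openGraph (M ∩ E)).Reachable s q ∨ (openGraph (Mᶜ ∩ E)).Reachable s q) := by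
  have hDT' : ¬ ((openGraph (Tᶜ ∩ E)).Reachable s q ∧ (openGraph (Tᶜᶜ ∩ E)).Reachable s q) := by
    rw [compl_compl]; exact fun h => hDT ⟨h.2, h.1⟩
  have hDM' : ¬ ((openGraph (Mᶜ ∩ E)).Reachable s q ∧ (openGraph (Mᶜᶜ ∩ E)).Reachable s q) := by
    rw [compl_compl]; exact fun h => hDM ⟨h.2, h.1⟩
  rcases hq with hq | hq <;> rcases hag with hag | hag
  · -- red, agrees with T: (T, M)
    obtain ⟨-, hnb, hz, hr⟩ := std_core (R := R) hkey hDT hDM hq hag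
    exact ⟨fun h => hz (h.resolve_right hnb), fun h => Or.inl (hr h)⟩
  · -- red, agrees with Tᶜ: (T, Mᶜ)
    obtain ⟨-, hnb, hz, hr⟩ := std_core (R := R) (M := Mᶜ) hkey hDT hDM' hq (agree_compl_left hag)
    rw [compl_compl] at hnb
    rw [zone_compl] at hz
    exact ⟨fun h => hz (h.resolve_left hnb), fun h => Or.inr (hr h)⟩
  · -- blue, agrees with T: (Tᶜ, Mᶜ)
    have hag' : ∀ e ∈ ZoneSys.blk E (zone E s R Tᶜ q), (e ∈ Mᶜ ↔ e ∈ Tᶜ) := by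
      rw [zone_compl]; exact agree_compl_both hag
    obtain ⟨-, hnb, hz, hr⟩ := std_core (R := R) (T := Tᶜ) (M := Mᶜ) hkey hDT' hDM' hq hag'
    rw [compl_compl] at hnb
    rw [zone_compl, zone_compl] at hz
    exact ⟨fun h => hz (h.resolve_left hnb), fun h => Or.inr (hr (by rw [zone_compl]; exact h))⟩
  · -- blue, agrees with Tᶜ: (Tᶜ, M)
    have hag' : ∀ e ∈ ZoneSys.blk E (zone E s R Tᶜ q), (e ∈ M ↔ e ∈ Tᶜ) := by
      rw [zone_compl]; exact fun e he => by rw [Set.mem_compl_iff]; exact hag e he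
    obtain ⟨-, hnb, hz, hr⟩ := std_core (R := R) (T := Tᶜ) (M := M) hkey hDT' hDM hq hag'
    rw [zone_compl] at hz
    exact ⟨fun h => hz (h.resolve_right hnb), fun h => Or.inl (hr (by rw [zone_compl]; exact h))⟩

/-- **The swallower.**  A swallowed unreached `r ∈ R` has a reached swallower `q₀ ∈ R`, `q₀ ≠ r`, whose (standard) zone equals the zone of
`r`. [this work] -/
theorem exists_swallower (hkey : ∀ (T : Set (Sym2 V)) (x : V), ¬ (openGraph (T ∩ E)).Reachable s x → ¬ (openGraph (Tᶜ ∩ E)).Reachable s x →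
      (∀ u, s(x, u) ∈ E → u ≠ x → s(x, u) ∈ T) ∨ (∀ u, s(x, u) ∈ E → u ≠ x → s(x, u) ∉ T))
    (hT : ∀ r ∈ R, ¬ ((openGraph (T ∩ E)).Reachable s r ∧ (openGraph (Tᶜ ∩ E)).Reachable s r))
    {r : V} (hr : ¬ (openGraph (T ∩ E)).Reachable s r) (hb : ¬ (openGraph (Tᶜ ∩ E)).Reachable s r) (hsw : r ∈ sw E s R T) :
    ∃ q₀ ∈ R, ((openGraph (T ∩ E)).Reachable s q₀ ∨ (openGraph (Tᶜ ∩ E)).Reachable s q₀) ∧ q₀ ≠ r ∧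
      zone E s R T q₀ = zone E s R T r ∧ r ∈ zone E s R T q₀ := by
  obtain ⟨q, hqR, hq, hqb, hqr⟩ := sw_witness hr hb hsw
  refine ⟨q, hqR, hq, hqr, ?_⟩
  suffices hz : zone E s R T q = zone E s R T r by exact ⟨hz, hz ▸ mem_zone_self⟩
  rw [zone_of_sw hr hb hsw]
  rcases hkey _ _ hr hb with hm | hm
  · rw [big_of_allRed hm] at hqb ⊢
    have hqr' : ¬ (openGraph (T ∩ E)).Reachable s q := not_reachable_of_mem_openCluster _ hqb hr
    rw [zone_of_blue (hT q hqR) (hq.resolve_left hqr'), openCluster_eq_of_mem _ hqb]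
  · rw [big_of_allBlue hm] at hqb ⊢
    have hqb' : ¬ (openGraph (Tᶜ ∩ E)).Reachable s q := not_reachable_of_mem_openCluster _ hqb hb
    rw [zone_of_red (hT q hqR) (hq.resolve_right hqb'), openCluster_eq_of_mem _ hqb]

/-- **No swallowing appears, red half**: under the hypotheses of `not_sw_of_unreached`, no reached `q' ∈ R` lies in the red
`M`-cluster of `r`. [this work] -/
theorem false_of_mem_redCluster (hkey : ∀ (T : Set (Sym2 V)) (x : V), ¬ (openGraph (T ∩ E)).Reachable s x → ¬ (openGraph (Tᶜ ∩ E)).Reachable s x →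
      (∀ u, s(x, u) ∈ E → u ≠ x → s(x, u) ∈ T) ∨ (∀ u, s(x, u) ∈ E → u ≠ x → s(x, u) ∉ T))
    (hT : ∀ r ∈ R, ¬ ((openGraph (T ∩ E)).Reachable s r ∧ (openGraph (Tᶜ ∩ E)).Reachable s r))
    (hM : ∀ r ∈ R, ¬ ((openGraph (M ∩ E)).Reachable s r ∧ (openGraph (Mᶜ ∩ E)).Reachable s r))
    (hag : ∀ u ∈ R, (∀ e ∈ ZoneSys.blk E (zone E s R T u), (e ∈ M ↔ e ∈ T)) ∨
      (∀ e ∈ ZoneSys.blk E (zone E s R T u), (e ∈ M ↔ e ∉ T)))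
    {r : V} (hrM : ¬ (openGraph (M ∩ E)).Reachable s r) (hbM : ¬ (openGraph (Mᶜ ∩ E)).Reachable s r)
    (hZT : zone E s R T r = {r})
    (HZ : ∀ q ∈ R, ((openGraph (T ∩ E)).Reachable s q ∨ (openGraph (Tᶜ ∩ E)).Reachable s q) → r ∈ zone E s R T q → q = r)
    {q' : V} (hq'R : q' ∈ R) (hq'M : (openGraph (M ∩ E)).Reachable s q' ∨ (openGraph (Mᶜ ∩ E)).Reachable s q')
    (hq'K : q' ∈ openCluster (M ∩ E) r) : False := by
  have hq'r : q' ≠ r := by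
    rintro rfl
    exact hq'M.elim hrM hbM
  have hq'nr : ¬ (openGraph (M ∩ E)).Reachable s q' := not_reachable_of_mem_openCluster _ hq'K hrM
  have hq'b : (openGraph (Mᶜ ∩ E)).Reachable s q' := hq'M.resolve_left hq'nr
  have hKq : r ∈ openCluster (M ∩ E) q' := (show (openGraph (M ∩ E)).Reachable r q' from hq'K).symm
  by_cases hq'T : (openGraph (T ∩ E)).Reachable s q' ∨ (openGraph (Tᶜ ∩ E)).Reachable s q'
  · -- (A) `q'` standard in `T`: its zone is invariant and contains `r`
    obtain ⟨hz, -⟩ := std_inv hkey (hT q' hq'R) (hM q' hq'R) hq'T (hag q' hq'R)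
    have hzM := hz hq'M
    rw [zone_of_blue (hM q' hq'R) hq'b] at hzM
    have : r ∈ zone E s R T q' := by rw [← hzM]; exact hKq
    exact hq'r (HZ q' hq'R hq'T this)
  · rw [not_or] at hq'T
    by_cases hsw' : q' ∈ sw E s R T
    · -- (B) `q'` swallowed in `T`: reduce to its swallower `q₀`
      obtain ⟨q₀, hq₀R, hq₀T, hq₀q', hZ₀, hq'Z₀⟩ := exists_swallower hkey hT hq'T.1 hq'T.2 hsw'
      obtain ⟨hz₀, hreach₀⟩ := std_inv hkey (hT q₀ hq₀R) (hM q₀ hq₀R) hq₀T (hag q₀ hq₀R)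
      have hq₀M := hreach₀ ⟨q', hq'Z₀, hq₀q'.symm⟩
      have hZM₀ := hz₀ hq₀M
      rcases hq₀M with h₀r | h₀b
      · rw [zone_of_red (hM q₀ hq₀R) h₀r] at hZM₀
        have : q' ∈ openCluster (Mᶜ ∩ E) q₀ := by rw [hZM₀]; exact hq'Z₀
        exact not_reachable_of_mem_openCluster _ this (fun h => hM q₀ hq₀R ⟨h₀r, h⟩) hq'b
      · rw [zone_of_blue (hM q₀ hq₀R) h₀b] at hZM₀
        have hq'c : q' ∈ openCluster (M ∩ E) q₀ := by rw [hZM₀]; exact hq'Z₀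
        have hrc : r ∈ openCluster (M ∩ E) q₀ := by rw [← openCluster_eq_of_mem _ hq'c]; exact hKq
        have : r ∈ zone E s R T q₀ := by rw [← hZM₀]; exact hrc
        have h := HZ q₀ hq₀R hq₀T this
        rw [h] at h₀b
        exact hbM h₀b
    · -- (C) `q'` small in `T`: its star is monochromatic in `T`, hence in `M`; but it has a red and a blue `M`-edge
      have hZ' := zone_of_small hq'T.1 hq'T.2 hsw'
      have hq's : q' ≠ s := ne_source_of_unreached hq'T.1
      obtain ⟨u, hu, huq, -⟩ := exists_adj_of_mem_openCluster _ hq'K hq'r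
      obtain ⟨w, hw, hwq⟩ := Apex.exists_adj_of_reachable hq's hq'b
      have hub : s(q', u) ∈ ZoneSys.blk E (zone E s R T q') := by
        rw [hZ']; exact ZoneSys.mk_mem_blk hu.2 huq.symm (Or.inl rfl)
      have hwb : s(q', w) ∈ ZoneSys.blk E (zone E s R T q') := by
        rw [hZ']; exact ZoneSys.mk_mem_blk hw.2 hwq.symm (Or.inl rfl)
      rcases hkey _ _ hq'T.1 hq'T.2 with hm | hm <;> rcases hag q' hq'R with ha | ha
      · exact hw.1 ((ha _ hwb).2 (hm w hw.2 hwq))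
      · exact (ha _ hub).1 hu.1 (hm u hu.2 huq)
      · exact hm u hu.2 huq ((ha _ hub).1 hu.1)
      · exact hw.1 ((ha _ hwb).2 (hm w hw.2 hwq))

/-- Agreement with `T` or `Tᶜ` on all blocks, transported to `(Tᶜ, Mᶜ)`. [this work] -/
theorem agree_all_compl
    (hag : ∀ u ∈ R, (∀ e ∈ ZoneSys.blk E (zone E s R T u), (e ∈ M ↔ e ∈ T)) ∨
      (∀ e ∈ ZoneSys.blk E (zone E s R T u), (e ∈ M ↔ e ∉ T))) :
    ∀ u ∈ R, (∀ e ∈ ZoneSys.blk E (zone E s R Tᶜ u), (e ∈ Mᶜ ↔ e ∈ Tᶜ)) ∨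
      (∀ e ∈ ZoneSys.blk E (zone E s R Tᶜ u), (e ∈ Mᶜ ↔ e ∉ Tᶜ)) := by
  intro u hu
  rw [zone_compl]
  rcases hag u hu with h | h
  · exact Or.inl (agree_compl_both h)
  · exact Or.inr fun e he => by rw [Set.mem_compl_iff, Set.mem_compl_iff, h e he, not_not]

/-- Agreement with `T` or `Tᶜ` on all blocks, transported to `(T, Mᶜ)`. [this work] -/
theorem agree_all_compl_right
    (hag : ∀ u ∈ R, (∀ e ∈ ZoneSys.blk E (zone E s R T u), (e ∈ M ↔ e ∈ T)) ∨
      (∀ e ∈ ZoneSys.blk E (zone E s R T u), (e ∈ M ↔ e ∉ T))) :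
    ∀ u ∈ R, (∀ e ∈ ZoneSys.blk E (zone E s R T u), (e ∈ Mᶜ ↔ e ∈ T)) ∨
      (∀ e ∈ ZoneSys.blk E (zone E s R T u), (e ∈ Mᶜ ↔ e ∉ T)) := by
  intro u hu
  rcases hag u hu with h | h
  · exact Or.inr fun e he => by rw [Set.mem_compl_iff, h e he]
  · exact Or.inl (agree_compl_left h)

/-- **No swallowing appears.**  `T, M` in the constraint set, `M` agreeing with `T` or `Tᶜ` on every block of `T`; `r` unreached in `M` with
`T`-zone `{r}`, and no reached `q ∈ R` other than `r` has `r` in its `T`-zone.  Then `r` is not swallowed in `M`. [this work] -/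
theorem not_sw_of_unreached (hkey : ∀ (T : Set (Sym2 V)) (x : V), ¬ (openGraph (T ∩ E)).Reachable s x → ¬ (openGraph (Tᶜ ∩ E)).Reachable s x →
      (∀ u, s(x, u) ∈ E → u ≠ x → s(x, u) ∈ T) ∨ (∀ u, s(x, u) ∈ E → u ≠ x → s(x, u) ∉ T))
    (hT : ∀ r ∈ R, ¬ ((openGraph (T ∩ E)).Reachable s r ∧ (openGraph (Tᶜ ∩ E)).Reachable s r))
    (hM : ∀ r ∈ R, ¬ ((openGraph (M ∩ E)).Reachable s r ∧ (openGraph (Mᶜ ∩ E)).Reachable s r))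
    (hag : ∀ u ∈ R, (∀ e ∈ ZoneSys.blk E (zone E s R T u), (e ∈ M ↔ e ∈ T)) ∨
      (∀ e ∈ ZoneSys.blk E (zone E s R T u), (e ∈ M ↔ e ∉ T)))
    {r : V} (hrM : ¬ (openGraph (M ∩ E)).Reachable s r) (hbM : ¬ (openGraph (Mᶜ ∩ E)).Reachable s r)
    (hZT : zone E s R T r = {r})
    (HZ : ∀ q ∈ R, ((openGraph (T ∩ E)).Reachable s q ∨ (openGraph (Tᶜ ∩ E)).Reachable s q) → r ∈ zone E s R T q → q = r) :
    r ∉ sw E s R M := by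
  rintro ⟨q', hq'R, hq'M, hq'K | hq'K⟩
  · exact false_of_mem_redCluster hkey hT hM hag hrM hbM hZT HZ hq'R hq'M hq'K
  · -- blue half: apply the red half to `(Tᶜ, Mᶜ)`
    have hbM' : ¬ (openGraph (Mᶜᶜ ∩ E)).Reachable s r := by rw [compl_compl]; exact hrM
    have hZT' : zone E s R Tᶜ r = {r} := by rw [zone_compl]; exact hZT
    have HZ' : ∀ q ∈ R, ((openGraph (Tᶜ ∩ E)).Reachable s q ∨ (openGraph (Tᶜᶜ ∩ E)).Reachable s q) →
        r ∈ zone E s R Tᶜ q → q = r := fun q hq h hz => by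
      rw [compl_compl] at h
      rw [zone_compl] at hz
      exact HZ q hq h.symm hz
    have hq'M' : (openGraph (Mᶜ ∩ E)).Reachable s q' ∨ (openGraph (Mᶜᶜ ∩ E)).Reachable s q' := by
      rw [compl_compl]; exact hq'M.symm
    exact false_of_mem_redCluster hkey (constraint_compl hT) (constraint_compl hM) (agree_all_compl hag) hbM hbM' hZT' HZ'
      hq'R hq'M' hq'K

end Invariance

end ACone

end Antithetic

end Summit.CriticalPhenomena.PercolationContinuityZ3.Theorems
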